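import Summits.ResolutionOfSingularities.ResolutionOfSingularities.Theorems.TameContactInsep
import Summits.ResolutionOfSingularities.ResolutionOfSingularities.Theorems.MaxContactCutTameCut
import HarnessLib

/-!
# MaxContactCutTameContactInsep — decomp-res COMPANION node «TameContactInsep» (lens-6 g18), tree file 2/2: all
weights, BY NAME on the MaxContactCut items

Content VERBATIM from the `CrossLens` section of the decomp-res lens-6 g18 COMPANION file
`HOME/decomp-res-lens-6/g18/TameContactInsep.lean`
(sha256 66dc0b21be89a4f7, 2212 l; its l. 1–2031 are the node «AbsoluteContactInsep» = the landed
`Theorems/AbsoluteQFrame*` / `AbsoluteContactInsep`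
chain and are not repeated; HOME = run/shared/lean/pub/decomp-res).  Critic: CRITIC-LEDGER row 141 (CLEARED
2026-08-30T20:24:52Z, DECIDED +1:
the tame contact theorem over every field; lens-4's tame–inseparable column collapses into 31571 BY KERNEL); split
per COMPANION-g18 §5.
Landed by decomp-res writer g7.  NO new aside (the tame–insep cells are theorems); row 137's single residual aside 28338
`LCNoWildContactFreeOffLocusTowers` stands.

This file (Theses cone): l. 2154–2209 — `noTameInsepOffLocusTowers_of_item`,
`noTameInsepNonPrincipalInLocusTowers_of_item`, `noTameInsepWildHuggingTowers_holds`,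
`noWildHuggingTowers_iff_wildWild`, `noOffLocusShadowTowers_iff_wild`, `noNonPrincipalInLocusTowers_iff_wild`,
`noSingularSurfaceHuggingTowers_iff_gamma`,
`noForcedTowers_iff_gamma` (imports `TameContactInsep` + the landed `MaxContactCutTameCut`).  PROVED, 0 sorry.
Supports 32260 / 30253 / 31572.

[WRITER NOTE (decomp-res writer g7): section split only.]

(Sources: Giraud1975; EGA IV 16.11.2; KimuraNiitsuma1980 Thm 3.4; EncinasVillamayor2000 Thm 4.9; CossartPiltant2008
Prop 4.2; CossartJannsenSaito2020; CossartPiltant2019.)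
-/

noncomputable section

open CategoryTheory AlgebraicGeometry IsLocalRing
open Literature.AlgebraicGeometry.Resolution
open Summit.ResolutionOfSingularities.ResolutionOfSingularities.Theses
open Summit.ResolutionOfSingularities.ResolutionOfSingularities.Theorems
open WeakOrderReduction ForcedTowerClasses DivergentTowerClasses MonomialTowerClasses
open HugDimensionClasses HugDimensionKernels SurfaceShadowClasses SurfaceShadowKernels
open NearPointCut (SingularClass)
open AbsoluteContactClasses (IsAbsContactAt SepResidueAt isAbsContactAt_of_not_dvd)

namespace Summit.ResolutionOfSingularities.ResolutionOfSingularities.Theorems.HugValuationCut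

section CrossLens

variable {k : Type} [Field k]

/-! ### all weights, BY NAME on the MaxContactCut items (Theses cone; as `MaxContactCutTameCut`) -/

/-- **KERNEL — (O, tame, inseparable root) over all weights from 31571 `NoContactHuggingTowers` BY NAME.** [folklore] -/
theorem noTameInsepOffLocusTowers_of_item (h : MaxContactCut.NoContactHuggingTowers) : NoTameInsepOffLocusTowers :=
  fun n hn => tameInsepOffLocus_of_contact (h n hn)

/-- **KERNEL — (L,¬P, tame, inseparable root) over all weights from 31571 BY NAME.** [folklore] -/
theorem noTameInsepNonPrincipalInLocusTowers_of_item (h : MaxContactCut.NoContactHuggingTowers) :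
    NoTameInsepNonPrincipalInLocusTowers :=
  fun n hn => tameInsepNonPrincipal_of_contact (h n hn)

/-- **KERNEL — (31572, tame, inseparable root) over all weights HOLDS (TRUE, no hypothesis).** [folklore] -/
theorem noTameInsepWildHuggingTowers_holds : NoTameInsepWildHuggingTowers :=
  fun _ _ => tameInsepWildHugging_empty

/-- **31572 `MaxContactCut.NoWildHuggingTowers` BY NAME, EXACT, hypothesis-free: `⟺ NoWildWildHuggingTowers`.** [folklore] -/
theorem noWildHuggingTowers_iff_wildWild : MaxContactCut.NoWildHuggingTowers ↔ NoWildWildHuggingTowers :=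
  noWildHuggingTowers_iff_g21.trans ⟨fun h => h.1, fun h => ⟨h, noTameInsepWildHuggingTowers_holds⟩⟩

/-- **EXACT RE-LOCATION of (O) over all weights GIVEN 31571: `⟺ NoWildOffLocusTowers`.** [folklore] -/
theorem noOffLocusShadowTowers_iff_wild (h71 : MaxContactCut.NoContactHuggingTowers) :
    NoOffLocusShadowTowers ↔ NoWildOffLocusTowers :=
  (noOffLocusShadowTowers_iff_g21 h71).trans ⟨fun h => h.1, fun h => ⟨h, noTameInsepOffLocusTowers_of_item h71⟩⟩

/-- **EXACT RE-LOCATION of (L,¬P) over all weights GIVEN 31571: `⟺ NoWildNonPrincipalInLocusTowers`.** [folklore] -/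
theorem noNonPrincipalInLocusTowers_iff_wild (h71 : MaxContactCut.NoContactHuggingTowers) :
    NoNonPrincipalInLocusTowers ↔ NoWildNonPrincipalInLocusTowers :=
  (noNonPrincipalInLocusTowers_iff_g21 h71).trans
    ⟨fun h => h.1, fun h => ⟨h, noTameInsepNonPrincipalInLocusTowers_of_item h71⟩⟩

/-- **THE HOST 32260 `MaxContactCut.NoSingularSurfaceHuggingTowers` EXACTLY, with g21's hypothesis list EXACTLY —
the two tame–inseparable conjuncts of `noSingularSurfaceHuggingTowers_iff_g21` DISCHARGED:
`⟺ (O, wild) ∧ (L,¬P, wild) ∧ (L,P,pure) ∧ (imperfect wild-drifting residual)`.** [folklore] -/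
theorem noSingularSurfaceHuggingTowers_iff_gamma (hMo : MaxContactCut.MonomialCornerAll) (hC : MaxContactCut.CurveLawAll)
    (hSL : MaxContactCut.SurfaceLawAll) (hH : MaxContactCut.NoHypersurfaceHuggingTowers) (hP : ShadowPortAll)
    (hM : MarkingPortAll) (hDesc : DescentPortAll) (hFC : FactorContactPortAll) (hCo : CouplingPortAll)
    (hRi : RiderPortAll) (h71 : MaxContactCut.NoContactHuggingTowers) :
    MaxContactCut.NoSingularSurfaceHuggingTowers ↔
      NoWildOffLocusTowers ∧ NoWildNonPrincipalInLocusTowers ∧ NoPurePrincipalTowers ∧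
        NoIncommensurableWildDriftingImperfectTowers := by
  rw [noSingularSurfaceHuggingTowers_iff_g21 hMo hC hSL hH hP hM hDesc hFC hCo hRi h71]
  exact ⟨fun h => ⟨h.1, h.2.2.1, h.2.2.2.2.1, h.2.2.2.2.2⟩, fun h => ⟨h.1, noTameInsepOffLocusTowers_of_item h71, h.2.1,
    noTameInsepNonPrincipalInLocusTowers_of_item h71, h.2.2.1, h.2.2.2⟩⟩

/-- **THE ROOT 30253 `MaxContactCut.NoForcedTowers` EXACTLY with g21's hypothesis list: `⟺ 31571 ∧` the four
cells.** [folklore] -/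
theorem noForcedTowers_iff_gamma (hMo : MaxContactCut.MonomialCornerAll) (hC : MaxContactCut.CurveLawAll)
    (hSL : MaxContactCut.SurfaceLawAll) (hH : MaxContactCut.NoHypersurfaceHuggingTowers) (hP : ShadowPortAll)
    (hM : MarkingPortAll) (hDesc : DescentPortAll) (hFC : FactorContactPortAll) (hCo : CouplingPortAll)
    (hRi : RiderPortAll) :
    MaxContactCut.NoForcedTowers ↔
      MaxContactCut.NoContactHuggingTowers ∧ NoWildOffLocusTowers ∧ NoWildNonPrincipalInLocusTowers ∧
        NoPurePrincipalTowers ∧ NoIncommensurableWildDriftingImperfectTowers := by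
  rw [noForcedTowers_iff_g21 hMo hC hSL hH hP hM hDesc hFC hCo hRi]
  exact ⟨fun h => ⟨h.1, h.2.1, h.2.2.2.1, h.2.2.2.2.2.1, h.2.2.2.2.2.2⟩, fun h => ⟨h.1, h.2.1,
    noTameInsepOffLocusTowers_of_item h.1, h.2.2.1, noTameInsepNonPrincipalInLocusTowers_of_item h.1, h.2.2.2.1, h.2.2.2.2⟩⟩

end CrossLens

end Summit.ResolutionOfSingularities.ResolutionOfSingularities.Theorems.HugValuationCut
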